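import Summits.QuantumFields.BalabanUV.Beta.EriceRemainderEnclosureHistoryAutonomyComparisonAgeCompositionTower16

/-!
# EriceRemainderEnclosureHistoryAutonomyComparisonAgeCompositionTower16Mid — (E106e) route (N), first order: THE RATIO-16 TOWER FOR EVERY YOUNG SECOND AGE.
# (E106d) `flow_nonneg_census_tower16` closes the census tower `{1, a_1, a_2, …}` (ratios `≥ 16`) for `a_1 ≥ 58` — the first old age must be old enough
# for the single cap `123∕200` and the pair letters (`j ≥ 56`).  This file and its sequel (E106f) `…Tower16Every` add the two YOUNG ENDS and the union:
# * **`flow_nonneg_census_tower16_mid`** — `30 ≤ a_1`, `a_2 ≥ 72·a_1`, ratios `≥ 16` above: levels `{1}, {a_1}, {a_2}, …` with `κ_0 := 2∕5` and the SCALED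
#   overshoot `κ_1 := (58a_1∕a_2)·G₃(X_2) ≤ (58∕72)·0.233` (closure of `{a_2}` by (E106c) `row₃` at `a′ = 58a_1`, rescaled; closure of `{a_1}` by
#   `x_{a_1} ≤ 77∕125` (`a_1 ≥ 30`, (E94b)) and `4·(77∕125)(1+κ̄₁)+κ̄₁ ≤ (2∕5)(1 − (77∕125)(1+κ̄₁))·30`; young closure `0.7072·(7∕5) ≤ 1`);
# * **`flow_nonneg_census_tower16_young_pair`** — `2 ≤ a_1 ≤ 29`, `a_2 ≥ 72·a_1`: levels `{1, a_1}, {a_2}, …` with the young-pair cap `0.8333` (E97c) and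
#   `κ_0 := (58a_1∕a_2)·G₃(X_2)`: `0.8333·(1 + (58∕72)·0.233) = 0.9897 ≤ 1`;
# * **`flow_nonneg_census_tower16_every`** — EVERY `a_1 ≥ 2` once `a_2 ≥ 72·a_1` and the ratios above are `≥ 16` (the three cases).
# So: the census profile `{1, k₂, k₃, k₄, …}` with ANY number of ages holds at first order for EVERY `k₂ ≥ 2`, `k₃ ≥ 72k₂`, `k_{j+1} ≥ 16k_j` (`j ≥ 3`).

Cell `pub-balaban`, β-function sub-cell, BINDER row D4 «RemainderConst leaves for Bałaban's split» (`HOME/BINDER-OWNERS.md`; owner lineage `b2b-balaban-beta-an4`;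
this file by co-owner #2 lineage `b2b-balaban-beta-d4-p2`, generation 90), β-FLOW TEAM duty (1), FREEZE (0) honoured (def-free; nothing restated).

HONEST FRAMING (page 1, verbatim and binding).  *"Discharging BetaPertH makes Bałaban's UV stability UNCONDITIONAL — a real constructive-QFT result; it is
NOT the continuum limit and NOT the Clay problem."*  THIS FILE DISCHARGES NOTHING OF THE KIND.  Elementary real algebra ∕ real analysis about ABSTRACT
functionals on a box ]0,γ]^ℕ with displayed floors, profiles and signs, and the FIRST-ORDER renewal objects of route (N) built from them — hypotheses of a
census, not facts; the form, signs, ages and moments of Bałaban's (1.22) limit functional are NOT PRINTED ([I] p. 298; GAPS G-t4-U2-1∕-2) and NOT asserted.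
Row D4 class UNCHANGED (critical-path width 0; instance 0∕1; D4 DISCHARGE NO DATE).  HONEST DEPENDENCY: continuum YM on T⁴ ⇐ BetaPertH ∧ nine spine
estimates (0/9 proved); BetaPertH ⇐ (D1) ∧ (D4) ∧ CAP+tail; G-an2-4 gates asym, D1 and NE2/3/4.

THE POINT (README `HOME/b2b-balaban-beta-d4-p2/g90/README.md` §3).  Uses (E101b) `flow_nonneg_adaptive_cluster_levels`, (E94b) `load_le_of_sq`, (E97c)
`young_pair_load_le`, (E106b) `closure_of_bounds`, `G₃_le`, `Mf_nonneg`, (E106c) `row₃`, (E106d) `envelope_of_next`, `tower_closure`, `flow_nonneg_census_tower16`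
BY NAME.  NOT CLAIMED: `a_2 < 72a_1` for `a_1 < 58`; ratios below 16; anything printed — NOT B12 Thm 2, NOT BetaPertH, NOT continuum, NOT Clay.

WHAT IS PROVED ([folklore]; 0 `def`, 0 sorry).  §1 **`flow_nonneg_census_tower16_mid`** (this file); the young-pair end and the union are the sequel
(E106f) `…Tower16Every`.
-/
noncomputable section
open Finset

namespace Summit.QuantumFields.BalabanUV.Beta.EriceRemainderEnclosureHistoryAutonomyComparisonAgeCompositionTower16Mid

open Literature.MathematicalPhysics.QuantumFieldTheory.Balaban1983to89
open Literature.MathematicalPhysics.QuantumFieldTheory.Balaban1983to89.T4BetaStationary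
open Literature.MathematicalPhysics.QuantumFieldTheory.Balaban1983to89.T4BetaFlowWellPosed
open Summit.QuantumFields.BalabanUV.Beta.EriceRemainderEnclosureHistoryAutonomyComparisonAgeCompositionYoungPairMoment (load_le_of_sq)
open Summit.QuantumFields.BalabanUV.Beta.EriceRemainderEnclosureHistoryAutonomyComparisonAgeCompositionAdaptiveLevels (flow_nonneg_adaptive_cluster_levels)
open Summit.QuantumFields.BalabanUV.Beta.EriceRemainderEnclosureHistoryAutonomyComparisonAgeCompositionTowerTable
open Summit.QuantumFields.BalabanUV.Beta.EriceRemainderEnclosureHistoryAutonomyComparisonAgeCompositionTowerTableRows (row₃)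
open Summit.QuantumFields.BalabanUV.Beta.EriceRemainderEnclosureHistoryAutonomyComparisonAgeCompositionTower16 (envelope_of_next tower_closure flow_nonneg_census_tower16)

variable {B : (ℕ → ℝ) → ℝ} {γ b gIR : ℝ} {L : ℕ → ℝ} {K : ℕ} {h g : ℕ → ℝ}

/-! ## §1 The middle young end: `30 ≤ a_1`, `a_2 ≥ 72a_1` -/

/-- **THE RATIO-16 TOWER WITH A MIDDLE-AGED SECOND LEVEL.**  Ages `a_0 = 1 < a_1 < a_2 < …` (`r ≥ 1` levels) with `30 ≤ a_1`, `72a_1 ≤ a_2`,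
`16a_j ≤ a_{j+1}` (`j ≥ 2`), all `< K`, the profile vanishing off them: `0 ≤ ε ≤ e` at every pin. [folklore] -/
theorem flow_nonneg_census_tower16_mid
    (hmono : ∀ u v : ℕ → ℝ, SeqBox γ u → SeqBox γ v → (∀ j, u j ≤ v j) → B u ≤ B v)
    (hL : ∀ k, 0 ≤ L k) (hb : 0 < b) (hlo : ∀ u, SeqBox γ u → b ≤ B u) (hdom : ∀ u, SeqBox γ u → ∑ k ∈ range K, L k * u k ≤ B u)
    (hh : SeqBox γ h) (hf : MemFlow B gIR h) (hg : ∀ t, 0 < g t ∧ g t ≤ 1)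
    (hgF : ∀ t, 1 ≤ g t * (1 + ∑ k ∈ range K, L k * h (t + k) ^ 3 / 2))
    {r : ℕ} {a : ℕ → ℕ} (hr : 1 ≤ r) (ha0 : a 0 = 1) (ha1 : 1 < r → 30 ≤ a 1) (ha2 : 2 < r → 72 * a 1 ≤ a 2)
    (haR : ∀ j, 2 ≤ j → j + 1 < r → 16 * a j ≤ a (j + 1)) (haK : ∀ j, j < r → a j < K)
    (hLa : ∀ l, l < K → (∀ j, j < r → l ≠ a j) → L l = 0)
    {N : ℕ} {KL : ℕ → ℕ → ℕ → ℝ}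
    (hKL : ∀ k n l, KL k n l = if 0 < k ∧ k < K ∧ l < k then L k * h (n + k) ^ 3 / 2 * ∏ t ∈ Ico (n + 1 + l) (n + k + 1), g t else 0)
    {KA : ℕ → ℕ → ℕ → ℝ} {RA : ℕ → (ℕ → ℝ) → ℕ → ℝ}
    (hRA : ∀ i v m, RA i v m = ∑ l ∈ range K, KA i m l * v (m + 1 + l))
    (hKA : ∀ i m l, KA i m l = KL i m l + KA (i + 1) m l) (hKAtop : ∀ m l, KA K m l = 0)
    {e ε : ℕ → ℝ} (he0 : ∀ m, 0 ≤ e m) (hea : ∀ m, e (m + 1) ≤ e m)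
    (hεt : ∀ m, N < m → ε m = 0) (hεrec : ∀ m, ε m = e m - RA 1 ε m) : ∀ m, 0 ≤ ε m ∧ ε m ≤ e m := by
  have hpos : ∀ n, 0 < h n := fun n => (hh n).1
  have hK : 1 ≤ K := by have := haK 0 (by omega); omega
  -- the ages: a_1 ≥ 30, a_j ≥ 58 from j = 2 on, increasing
  have h58 : ∀ j, 2 ≤ j → j < r → 58 ≤ a j := by
    intro j hj hjr
    induction j with
    | zero => omega
    | succ i ih =>
      rcases Nat.lt_or_ge i 2 with hi2 | hi2
      · have hi1 : i = 1 := by omega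
        subst hi1; show 58 ≤ a 2; have := ha1 (by omega); have := ha2 (by omega); omega
      · have := ih hi2 (by omega); have := haR i hi2 (by omega); omega
  have hlt : ∀ j, j + 1 < r → a j < a (j + 1) := by
    intro j hjr
    rcases Nat.lt_or_ge j 2 with hj2 | hj2
    · interval_cases j
      · show a 0 < a 1; rw [ha0]; have := ha1 (by omega); omega
      · show a 1 < a 2; have := ha1 (by omega); have := ha2 (by omega); omega
    · have := haR j hj2 hjr; have := h58 j hj2 (by omega); omega
  have hsm : ∀ i j, i < j → j < r → a i < a j := by
    intro i j hij hjr
    induction j with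
    | zero => omega
    | succ j ih =>
      rcases Nat.lt_or_ge i j with hij' | hij'
      · exact lt_trans (ih hij' (by omega)) (hlt j hjr)
      · have : i = j := by omega
        subst this; exact hlt i hjr
  have ha1' : ∀ j, j < r → 1 ≤ a j := by
    intro j hjr
    rcases Nat.lt_or_ge j 2 with hj2 | hj2
    · interval_cases j
      · omega
      · have := ha1 (by omega); omega
    · have := h58 j hj2 hjr; omega
  -- loads and caps
  obtain ⟨X, hX⟩ : ∃ X : ℕ → ℕ → ℝ, ∀ j q, X j q = (a j : ℝ) * (L (a j) * h (q + a j) ^ 3 / 2) := ⟨_, fun _ _ => rfl⟩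
  have hX0 : ∀ j q, 0 ≤ X j q := fun j q => by rw [hX]; have := hL (a j); have := hpos (q + a j); positivity
  have hXy : ∀ q, X 0 q ≤ 7072 / 10000 := fun q => by
    rw [hX, ha0]
    exact load_le_of_sq hmono hL hb hlo hdom hh hf (k := 1) le_rfl (by have := haK 0 (by omega); rwa [ha0] at this) (so := 7072 / 10000)
      (by norm_num) (by norm_num) q
  have hX1 : ∀ q, 1 < r → X 1 q ≤ 77 / 125 := fun q h1r => by
    rw [hX]
    have h30 : (30 : ℝ) ≤ a 1 := by exact_mod_cast ha1 h1r
    exact load_le_of_sq hmono hL hb hlo hdom hh hf (ha1' 1 h1r) (haK 1 h1r) (so := 77 / 125) (by norm_num) (by nlinarith [h30]) q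
  have hXc : ∀ j q, 2 ≤ j → j < r → X j q ≤ 123 / 200 := fun j q hj hjr => by
    rw [hX]
    have h58j : (58 : ℝ) ≤ a j := by exact_mod_cast h58 j hj hjr
    exact load_le_of_sq hmono hL hb hlo hdom hh hf (ha1' j hjr) (haK j hjr) (so := 123 / 200) (by norm_num) (by nlinarith [h58j]) q
  -- THE TABLE (E106b) and the overshoots: κ_0 = 2∕5, κ_1 scaled, κ_j (j ≥ 2) from the next load
  obtain ⟨G₁, hG₁⟩ : ∃ G₁ : ℝ → ℝ, ∀ x, G₁ x = if x ≤ 7 / 25 then if x ≤ 4 / 25 then if x ≤ 3 / 25 then if x ≤ 2 / 25 then if x ≤ 1 / 25 then 77 / 1000 else 53 / 500 else 139 / 1000 else if x ≤ 7 / 50 then 159 / 1000 else 9 / 50 else if x ≤ 1 / 5 then if x ≤ 37 / 200 then 193 / 1000 else 211 / 1000 else if x ≤ 6 / 25 then 219 / 1000 else 231 / 1000 else if x ≤ 12 / 25 then if x ≤ 2 / 5 then if x ≤ 9 / 25 then if x ≤ 8 / 25 then 257 / 1000 else 289 / 1000 else 163 / 500 else if x ≤ 11 / 25 then 37 / 100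 else 421 / 1000 else if x ≤ 14 / 25 then if x ≤ 13 / 25 then 61 / 125 else 121 / 200 else if x ≤ 3 / 5 then 767 / 1000 else 169 / 200 := ⟨_, fun _ => rfl⟩
  obtain ⟨G₂, hG₂⟩ : ∃ G₂ : ℝ → ℝ, ∀ x, G₂ x = if x ≤ 7 / 25 then if x ≤ 4 / 25 then if x ≤ 3 / 25 then if x ≤ 2 / 25 then if x ≤ 1 / 25 then 39 / 1000 else 53 / 1000 else 7 / 100 else if x ≤ 7 / 50 then 2 / 25 else 9 / 100 else if x ≤ 1 / 5 then if x ≤ 37 / 200 then 97 / 1000 else 53 / 500 else if x ≤ 6 / 25 then 11 / 100 else 29 / 250 else if x ≤ 12 / 25 then if x ≤ 2 / 5 then if x ≤ 9 / 25 then if x ≤ 8 / 25 then 129 / 1000 else 29 / 200 else 163 / 1000 else if x ≤ 11 / 25 then 37 / 200 else 211 / 1000 else if x ≤ 14 / 25 then if x ≤ 13 / 25 then 61 / 250 else 303 / 1000 else if x ≤ 3 / 5 then 48 / 125 else 423 / 1000 := ⟨_, fun _ => rfl⟩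
  obtain ⟨G₃, hG₃⟩ : ∃ G₃ : ℝ → ℝ, ∀ x, G₃ x = if x ≤ 7 / 25 then if x ≤ 4 / 25 then if x ≤ 3 / 25 then if x ≤ 2 / 25 then if x ≤ 1 / 25 then 11 / 500 else 3 / 100 else 39 / 1000 else if x ≤ 7 / 50 then 11 / 250 else 1 / 20 else if x ≤ 1 / 5 then if x ≤ 37 / 200 then 27 / 500 else 59 / 1000 else if x ≤ 6 / 25 then 61 / 1000 else 8 / 125 else if x ≤ 12 / 25 then if x ≤ 2 / 5 then if x ≤ 9 / 25 then if x ≤ 8 / 25 then 71 / 1000 else 2 / 25 else 9 / 100 else if x ≤ 11 / 25 then 51 / 500 else 117 / 1000 else if x ≤ 14 / 25 then if x ≤ 13 / 25 then 27 / 200 else 167 / 1000 else if x ≤ 3 / 5 then 53 / 250 else 233 / 1000 := ⟨_, fun _ => rfl⟩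
  obtain ⟨Mf, hM⟩ : ∃ Mf : ℝ → ℝ, ∀ x, Mf x = if x < 8 / 25 then if x < 6 / 25 then if x < 1 / 5 then if x < 4 / 25 then 169 / 200 else 767 / 1000 else 121 / 200 else if x < 7 / 25 then 61 / 125 else 421 / 1000 else if x < 11 / 25 then if x < 2 / 5 then if x < 9 / 25 then 37 / 100 else 163 / 500 else 289 / 1000 else if x < 12 / 25 then 257 / 1000 else 233 / 1000 := ⟨_, fun _ => rfl⟩
  obtain ⟨T, hT⟩ : ∃ T : ℕ → ℕ → ℝ → ℝ, ∀ lo hi x, T lo hi x = if 58 * lo ≤ hi then G₃ x else if 32 * lo < hi then G₂ x else G₁ x :=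
    ⟨_, fun _ _ _ => rfl⟩
  have hT0 : ∀ lo hi x, 0 ≤ T lo hi x := fun lo hi x => by
    rw [hT]; split_ifs
    exacts [G₃_nonneg hG₃ x, G₂_nonneg hG₂ x, G₁_nonneg hG₁ x]
  obtain ⟨κ, hκ⟩ : ∃ κ : ℕ → ℕ → ℝ, ∀ j q, κ j q = if j = 0 then 2 / 5 else if j = 1 then (if 2 < r then 58 * (a 1 : ℝ) / (a 2 : ℝ) * G₃ (X 2 q) else 0)
      else (if j + 1 < r then T (a j) (a (j + 1)) (X (j + 1) q) else 0) := ⟨_, fun _ _ => rfl⟩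
  have hκ0v : ∀ q, κ 0 q = 2 / 5 := fun q => by rw [hκ, if_pos rfl]
  have hκ1b : ∀ q, 0 ≤ κ 1 q ∧ κ 1 q ≤ 6757 / 36000 := by
    intro q
    rw [hκ, if_neg one_ne_zero, if_pos rfl]
    split_ifs with h2r
    · have ha1p : (0 : ℝ) < a 1 := by exact_mod_cast ha1' 1 (by omega)
      have ha2p : (0 : ℝ) < a 2 := by exact_mod_cast ha1' 2 h2r
      have h72 : 72 * (a 1 : ℝ) ≤ a 2 := by exact_mod_cast ha2 h2r
      have hG := G₃_le hG₃ (X 2 q)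
      have hG0 := G₃_nonneg hG₃ (X 2 q)
      have hq : 58 * (a 1 : ℝ) / (a 2 : ℝ) ≤ 58 / 72 := by rw [div_le_iff₀ ha2p]; linarith
      have hq0 : 0 ≤ 58 * (a 1 : ℝ) / (a 2 : ℝ) := by positivity
      constructor
      · positivity
      · calc 58 * (a 1 : ℝ) / (a 2 : ℝ) * G₃ (X 2 q) ≤ 58 / 72 * (233 / 1000) := mul_le_mul hq hG hG0 (by norm_num)
          _ = 6757 / 36000 := by norm_num
    · exact ⟨le_rfl, by norm_num⟩
  have hκ0 : ∀ j q, 0 ≤ κ j q := by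
    intro j q
    rcases Nat.lt_or_ge j 2 with hj2 | hj2
    · interval_cases j
      · rw [hκ0v]; norm_num
      · exact (hκ1b q).1
    · rw [hκ, if_neg (by omega), if_neg (by omega)]
      split_ifs
      exacts [hT0 _ _ _, le_rfl]
  -- LEMMA A for the tower levels j ≥ 2
  have hA : ∀ j q, 2 ≤ j → j < r → κ j q ≤ Mf (X j q) := by
    intro j q hj hjr
    rw [hκ, if_neg (by omega), if_neg (by omega)]
    split_ifs with hj1
    · rw [hT, hX, hX]
      exact envelope_of_next hmono hL hb hlo hdom hh hf hG₁ hG₂ hG₃ hM (le_trans (by norm_num) (h58 j hj hjr)) (haR j hj hj1) (haK (j + 1) hj1) q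
    · rw [hX]; exact Mf_nonneg hM _
  -- THE ENGINE (E101b) with singleton levels
  obtain ⟨S, hS⟩ : ∃ S : ℕ → Finset ℕ, ∀ j, S j = {a j} := ⟨_, fun _ => rfl⟩
  have hsum : ∀ j q, ∑ k ∈ S j, (k : ℝ) * (L k * h (q + k) ^ 3 / 2) = X j q := fun j q => by rw [hS, sum_singleton, hX]
  refine flow_nonneg_adaptive_cluster_levels hmono hL hb hlo hdom hh hf hg hgF hK (r := r) (S := S) (lo := a) (hi := a) (κ := κ) hκ0
    (fun j hj k hk => ?_) (fun j hj k hk => ?_) (fun j hj k hk => ?_) (fun j _ _ => le_rfl) (fun j _ hj => ha1' j hj)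
    (fun j hj => (hlt j hj).le) (fun i j hij hjr => ?_) (fun l hl hnot => ?_) (fun q => ?_) (fun j q hj1 hjr => ?_)
    hKL hRA hKA hKAtop he0 hea hεt hεrec
  · rw [hS, mem_singleton] at hk; subst hk; exact ⟨ha1' j hj, haK j hj⟩
  · rw [hS, mem_singleton] at hk; subst hk; exact le_rfl
  · rw [hS, mem_singleton] at hk; subst hk; exact le_rfl
  · rw [hS, hS, disjoint_singleton_left, mem_singleton]; exact (hsm i j hij hjr).ne
  · exact hLa l hl fun j hj hlj => hnot j hj (by rw [hS, hlj]; exact mem_singleton_self _)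
  · -- the youngest closure: x_1·(1 + 2∕5) ≤ 0.7072·1.4 ≤ 1
    rw [hsum, hκ0v]
    have := hXy q
    have := hX0 0 q
    nlinarith
  · rw [hsum]
    rcases Nat.lt_or_ge j 3 with hj3 | hj3
    · interval_cases j
      · -- level {a_1}: κ_0 = 2∕5, κ_1 ≤ 6757∕36000, x ≤ 77∕125, a_1 ≥ 30·a_0
        rw [hκ0v]
        have hR : (30 : ℝ) * (a 0 : ℝ) ≤ (a (1 : ℕ) : ℝ) := by rw [ha0]; push_cast; exact_mod_cast ha1 hjr
        exact closure_of_bounds (Nat.cast_nonneg _) (Nat.cast_nonneg _) hR (hX0 1 q) (hX1 q hjr) (hκ1b q).1 (hκ1b q).2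
          (by norm_num) (by norm_num) (by norm_num)
      · -- level {a_2}: κ_1 = (58a_1∕a_2)·G₃(X_2) — `row₃` at a′ = 58a_1, rescaled
        have hκ1 : κ 1 q = 58 * (a 1 : ℝ) / (a 2 : ℝ) * G₃ (X 2 q) := by rw [hκ, if_neg one_ne_zero, if_pos rfl, if_pos hjr]
        have ha1n : (0 : ℝ) ≤ (a 1 : ℝ) := Nat.cast_nonneg _
        have ha2p : (0 : ℝ) < (a 2 : ℝ) := by exact_mod_cast ha1' 2 hjr
        obtain ⟨h1, h2⟩ := row₃ hG₃ hM (a := (a 1 : ℝ)) (a' := 58 * (a 1 : ℝ)) ha1n (by positivity) le_rfl (hX0 2 q) (hXc 2 q le_rfl hjr)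
          (hκ0 2 q) (hA 2 q le_rfl hjr)
        refine ⟨h1, ?_⟩
        have e1 : κ (2 - 1) q * (1 - X 2 q * (1 + κ 2 q)) * (a 2 : ℝ) = G₃ (X 2 q) * (1 - X 2 q * (1 + κ 2 q)) * (58 * (a 1 : ℝ)) := by
          rw [show 2 - 1 = 1 from rfl, hκ1]; field_simp
        rw [e1]; exact h2
    · -- the tower levels j ≥ 3: `tower_closure`
      have hjm : j - 1 + 1 = j := by omega
      have h16 : 16 * a (j - 1) ≤ a j := by have := haR (j - 1) (by omega) (by omega); rwa [hjm] at this
      exact tower_closure hG₁ hG₂ hG₃ hM h16 (hX0 j q) (hXc j q (by omega) hjr) (hκ0 j q) (hA j q (by omega) hjr)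
        (by rw [hκ, if_neg (by omega), if_neg (by omega), if_pos (by omega), hjm, hT])

end Summit.QuantumFields.BalabanUV.Beta.EriceRemainderEnclosureHistoryAutonomyComparisonAgeCompositionTower16Mid
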